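import Summits.QuantumFields.BalabanUV.T4Continuum.Support.NE7SliceGreenTorus
import Literature.MathematicalPhysics.QuantumFieldTheory.Balaban1983to89.Beta.FluctuationProjection
import Literature.MathematicalPhysics.QuantumFieldTheory.Balaban1983to89.T4EtaRateOperatorTorus
import Summits.QuantumFields.BalabanUV.T4Continuum.Support.SmallCouplingEntryDecay
import Summits.QuantumFields.BalabanUV.T4Continuum.Support.AveragingKernelRows
import HarnessLib

/-!
# NE7SliceGreenDecayRows — THE DECAYING ROWS FOR THE LOCALISED SLICE SOLVER LETTER (torus side, `U = 1`): the far column sums of lit-balaban's `H_k`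
# (`Σ_{j ∈ S_f} |H_k(j,b)| ≤ (d+1)n^{d+1}M_Gc_PK·e^{m(s − ℓ₀)}` for `S_f` at block distance `≥ ℓ₀` and `b` within `s` of the centre block), the support of `Q_ke_i`
# (blocks within distance `1` of the block of `i`), and GAN24's (1.110) gradient row of `Δ_1⁻¹` SUMMED OVER BLOCKS (`|∇Δ_1⁻¹J(x)| ≤ C·Σ_{y′} e^{−δ₀|y₀−y′|_T}·B(y′)`)

Cell `pub-balaban`, rung (B)+1 sub-cell t4, lineage `b2b-balaban-t4-ne7-p1` (CRUX PROVER NE7 #1 = OWNER of row NE7), generation 89; memo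
`t4/b2b-balaban-t4-ne7-p1-g89/COSTING-N1.md` §3.  File F253a, the first half of the localised G♭ (F253b `NE7SliceGreenTorusLocalised` is the source bound and the END).
Over lit-balaban `B5Hk163Torus.norm_HkOp_le` (pointwise kernel decay of `H_k`), `B5Hk163TorusHolderRate.sum_exp_torusSupNorm_sub_rep_le` (volume-uniform torus sums),
the β sub-cell's digit lemmas `Beta.FluctuationProjection.bpt_add_tstep_of_lt ∕ _of_le ∕ bpt_blockOf_digitOf`, the torus-distance bookkeeping
`SmallCouplingEntryDecay.torusSupNorm_rep_triangle`, `AveragingKernelRows.torusSupNorm_rep_sub_comm`, `T4EtaRateOperatorTorus.torusSupNorm_neg ∕ _zero`, `B4TorusKernel.MultiPeriod.torusSupNorm_translate ∕ circAbs_le_abs`, and the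
SHAPE of GAN24's `B5Prop12Entries110.Entry110Grad` (taken as a hypothesis `hrow` in §4; instantiated by `Entry110Rect.entry110Grad_one` in F253b).

WHY (torus road v2; F252 `NE7ApeFlatSkeletonLocalised`, memo §3).  G1 `NE7SliceGreenTorus` bounds the plaquette values of a `ker Q_k` field by the GLOBAL sup of its
Hessian source; the cutoff road needs far sources DISCOUNTED by `e^{−c·dist}` (print's (161)∕(163) of [Balaban1985Variational] Sect. F).  The two kernel-decay inputs are
in the tree (lit-balaban's `H_k`, GAN24's `∇Δ_1⁻¹`); this file packages them in the three shapes the localised letter consumes.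
WHAT ([folklore]; 0 def, 0 sorry; dimension `d + 1`).
§1 `tsn_rep_add_unitVec_le_one` (block-distance bookkeeping on `rep`-differences; symmetry and the triangle inequality are the tree's `AveragingKernelRows.torusSupNorm_rep_sub_comm`, `SmallCouplingEntryDecay.torusSupNorm_rep_triangle`).
§2 **`tsn_le_one_of_QvOp_single_ne_zero`** — `(Q_ke_i)(b) ≠ 0 ⟹` the block of `i` is `b.1` or `b.1 + e_{b.2}`, so at block distance `≤ 1` from `b.1`.
§3 **`sum_far_norm_HkOp_col_le`** — the far column sums of `H_k` (any rate `0 < m < κ′ = κ_{163}∕(d+1)`).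
§4 **`norm_fdiff_inv_mulVec_le_blockwise`** — the (1.110) gradient row summed over the block decomposition of the source.
HONEST FRAMING (page 1): compositions of tree theorems at `U = 1`; nothing printed is asserted ([B5] (1.110) p. 35, (1.63) p. 29 are TEXT LOCATIONS); NOT (APE), NOT
ONE-STEP, NOT NE7; spine 0∕9; finite T⁴ rung (B)+1 — NOT infinite volume, NOT mass gap, NOT `BetaPertH`, NOT Clay.  Continuum YM on T⁴ ⇐ BetaPertH ∧ nine spine
estimates (0/9 proved); BetaPertH ⇐ (D1) ∧ (D4) ∧ CAP+tail; G-an2-4 gates asym, D1 and NE2/3/4.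
-/

set_option autoImplicit false

open scoped BigOperators Matrix ComplexConjugate
open Finset

namespace Summit.QuantumFields.BalabanUV.T4Continuum.NE7SliceGreenDecayRows

open Literature.MathematicalPhysics.QuantumFieldTheory.Balaban1983to89
open B5Prop11Plancherel (Tor fine fdiff unitVec)
open B5Action121 (Fs CurlOp)
open B5Block118 (QvOp bpt tstep)
open B5Blocks16 (blockOf blockOf_bpt bpt_bijective)
open B5DeltaA169 (DeltaA)
open B5Hk163Torus (HkOp QvOp_HkOp_mulVec norm_HkOp_le)
open B5Hk163RDiv (curl_HkOp_orthogonal)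
open B5Hk163Strip (kappa163 kappa163_pos)
open B5Hk163Decay (MG163 MG163_nonneg)
open B4TorusKernel (periodConst)
open B4TorusKernel.MultiPeriod (torusSupNorm torusSupNorm_nonneg torusSupNorm_translate translate circAbs circAbs_le_abs)
open B4Sect5Proof (latticeConst latticeConst_nonneg)
open B5Kernel166Decay (periodConst_pos)
open B5Hk163TorusHolderRate (sum_exp_torusSupNorm_sub_rep_le)
open B6LowerBound2153Torus (toT rep toT_rep toT_add toT_unitVec isPeriod_rep_toT_sub)
open B6Cov2156Torus (one_le_M)
open SmallCouplingEntryDecay (torusSupNorm_rep_triangle)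
open AveragingKernelRows (torusSupNorm_rep_sub_comm)
open T4EtaRateOperatorTorus (torusSupNorm_neg torusSupNorm_zero)
open Beta.FluctuationProjection (digitOf bpt_blockOf_digitOf bpt_add_tstep_of_lt bpt_add_tstep_of_le)
open NE7SliceGreenTorus (sum_norm_QvOp_mulVec_le sum_norm_HkOp_QvOp_mulVec_le curlAdjCurl_mulVec_apply Fs_eq_fdiff_DeltaA_inv)

noncomputable section

variable {d : ℕ}

/-! ## §1 Torus block-distance bookkeeping -/

section Dist

variable (M : Fin (d + 1) → ℕ) [∀ μ, NeZero (M μ)]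

/-- a unit step of the coarse torus has block distance `≤ 1`. [folklore] -/
theorem tsn_rep_add_unitVec_le_one (y : Tor M) (μ : Fin (d + 1)) :
    torusSupNorm M (rep M (y + unitVec M μ) - rep M y) ≤ 1 := by
  -- `rep (y + e_μ) − rep y` is the integer unit vector up to a period
  have hP := isPeriod_rep_toT_sub M (rep M y + B6BondElimination.unitVec μ)
  have htoT : toT M (rep M y + B6BondElimination.unitVec μ) = y + unitVec M μ := by
    rw [toT_add, toT_rep, toT_unitVec]
  rw [htoT] at hP
  choose m hm using hP
  have heq : rep M (y + unitVec M μ) - rep M y = translate M (B6BondElimination.unitVec μ) m := by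
    funext i
    have hi := hm i
    simp only [Pi.sub_apply, Pi.add_apply] at hi
    simp only [Pi.sub_apply, B4TorusKernel.MultiPeriod.translate]
    linarith
  rw [heq, torusSupNorm_translate]
  unfold torusSupNorm
  refine Finset.sup'_le _ _ fun i _ => ?_
  have h1 : (circAbs (M i) (B6BondElimination.unitVec μ i) : ℤ) ≤ |B6BondElimination.unitVec μ i| := circAbs_le_abs (one_le_M M i) _
  have h2 : |B6BondElimination.unitVec (d := d + 1) μ i| ≤ 1 := by
    unfold B6BondElimination.unitVec
    split_ifs <;> simp
  exact_mod_cast h1.trans h2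

end Dist

/-! ## §2 The support of `Q_ke_i`: coarse bonds whose straight contour passes through `i` start in the block of `i` or in the previous block -/

section Support

variable (n : ℕ) [NeZero n] (M : Fin (d + 1) → ℕ) [∀ μ, NeZero (M μ)]

/-- **SUPPORT OF `Q_ke_i`**: if `(Q_ke_i)(b) ≠ 0` then the block of `i` is `b.1` or `b.1 + e_{b.2}` (digit lemmas), hence at block distance `≤ 1` from `b.1`. [folklore] -/
theorem tsn_le_one_of_QvOp_single_ne_zero (i : Tor (fine n M) × Fin (d + 1)) (b : Tor M × Fin (d + 1))
    (hb : (QvOp n M *ᵥ (Pi.single i (1 : ℂ))) b ≠ 0) :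
    torusSupNorm M (rep M (blockOf n M i.1) - rep M b.1) ≤ 1 := by
  rw [Matrix.mulVec_single_one, Matrix.col_apply] at hb
  unfold QvOp at hb
  split_ifs at hb with h2
  · obtain ⟨j, -, hj⟩ := Finset.exists_ne_zero_of_sum_ne_zero hb
    obtain ⟨t, -, ht⟩ := Finset.exists_ne_zero_of_sum_ne_zero hj
    have hit : i.1 = bpt n M b.1 j + tstep (fine n M) b.2 t := by
      by_contra h
      exact ht (if_neg h)
    have htn : (t : ℕ) < n := t.isLt
    have hjn : ((j b.2 : ℕ)) < n := (j b.2).isLt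
    by_cases hlt : (j b.2 : ℕ) + t < n
    · -- same block
      rw [bpt_add_tstep_of_lt n M b.1 j b.2 t hlt] at hit
      rw [hit, blockOf_bpt, sub_self, torusSupNorm_zero]
      exact zero_le_one
    · -- next block
      have hle : n ≤ (j b.2 : ℕ) + t := by omega
      have h' : (j b.2 : ℕ) + t - n < n := by omega
      rw [bpt_add_tstep_of_le n M b.1 j b.2 t hle h'] at hit
      rw [hit, blockOf_bpt]
      exact tsn_rep_add_unitVec_le_one M b.1 b.2
  · exact absurd rfl hb

end Support

/-! ## §3 Far column sums of `H_k` -/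

section Columns

variable (n : ℕ) [NeZero n] (M : Fin (d + 1) → ℕ) [∀ μ, NeZero (M μ)]

/-- **FAR COLUMN SUMS OF `H_k`**: for a bond set `S_f` all of whose blocks are at block distance `≥ ℓ₀` from `y₀`, a coarse bond `b` at block distance `≤ s` from `y₀`,
and any rate `0 < m < κ′` (`κ′ = κ_{163}(d+1)∕(d+1)`): `Σ_{j ∈ S_f} |H_k(j, b)| ≤ (d+1)·n^{d+1}·M_G·c_P·K_{d+1}(κ′ − m)·e^{m(s − ℓ₀)}` — lit-balaban's pointwise decay
`norm_HkOp_le`, the triangle inequality `dist(blk j, b) ≥ ℓ₀ − s`, and the volume-uniform torus sum at the rate `κ′ − m`. [folklore] -/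
theorem sum_far_norm_HkOp_col_le (y₀ : Tor M) (ℓ₀ s : ℝ) (Sf : Finset (Tor (fine n M) × Fin (d + 1)))
    (hSf : ∀ j ∈ Sf, ℓ₀ ≤ torusSupNorm M (rep M (blockOf n M j.1) - rep M y₀))
    (b : Tor M × Fin (d + 1)) (hbs : torusSupNorm M (rep M b.1 - rep M y₀) ≤ s)
    {m : ℝ} (hm0 : 0 < m) (hmκ : m < kappa163 (d + 1) / (d + 1)) :
    ∑ j ∈ Sf, ‖HkOp n M j b‖
      ≤ ((d + 1 : ℕ) : ℝ) * (n : ℝ) ^ (d + 1)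
          * (MG163 (d + 1) * periodConst (kappa163 (d + 1)) d * latticeConst (d + 1) (kappa163 (d + 1) / (d + 1) - m))
          * Real.exp (m * (s - ℓ₀)) := by
  set κ' := kappa163 (d + 1) / (d + 1) with hκ'
  have hκm : 0 < κ' - m := by linarith
  have hMG := MG163_nonneg (d + 1)
  have hpC := (periodConst_pos (kappa163_pos (d + 1)) d).le
  obtain ⟨yb, lam⟩ := b
  -- one far entry: decay split at the rate `m`
  have hent : ∀ j ∈ Sf, ‖HkOp n M j (yb, lam)‖
      ≤ MG163 (d + 1) * periodConst (kappa163 (d + 1)) d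
          * Real.exp (-((κ' - m) * torusSupNorm M (rep M yb - rep M (blockOf n M j.1)))) * Real.exp (m * (s - ℓ₀)) := by
    intro j hj
    obtain ⟨q, μ⟩ := j
    -- write the fine point through its block and digit
    have hq : q = bpt n M (toT M (rep M (blockOf n M q))) (digitOf n M q) := by rw [toT_rep, bpt_blockOf_digitOf]
    have h := norm_HkOp_le n M μ lam (digitOf n M q) (rep M (blockOf n M q)) (rep M yb)
    rw [← hq, toT_rep] at h
    -- the distance from the block of `j` to `b` is at least `ℓ₀ − s`
    have hD : ℓ₀ - s ≤ torusSupNorm M (rep M (blockOf n M q) - rep M yb) := by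
      have htri := torusSupNorm_rep_triangle M (blockOf n M q) yb y₀
      have hfar := hSf (q, μ) hj
      simp only at hfar hbs
      linarith
    have hsym : torusSupNorm M (rep M (blockOf n M q) - rep M yb) = torusSupNorm M (rep M yb - rep M (blockOf n M q)) := torusSupNorm_rep_sub_comm M _ _
    set D := torusSupNorm M (rep M yb - rep M (blockOf n M q)) with hDdef
    rw [hsym] at hD
    have hsplit : Real.exp (-(κ' * D)) ≤ Real.exp (-((κ' - m) * D)) * Real.exp (m * (s - ℓ₀)) := by
      rw [← Real.exp_add]
      exact Real.exp_le_exp.mpr (by nlinarith)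
    calc ‖HkOp n M (q, μ) (yb, lam)‖ ≤ MG163 (d + 1) * periodConst (kappa163 (d + 1)) d * Real.exp (-(κ' * D)) := by rw [hsym] at h; exact h
      _ ≤ MG163 (d + 1) * periodConst (kappa163 (d + 1)) d * (Real.exp (-((κ' - m) * D)) * Real.exp (m * (s - ℓ₀))) :=
          mul_le_mul_of_nonneg_left hsplit (mul_nonneg hMG hpC)
      _ = _ := by ring
  -- sum over ALL fine bonds at the rate `κ′ − m` (G1 §2's computation)
  have htor := sum_exp_torusSupNorm_sub_rep_le M hκm (rep M yb)
  have hall : ∑ j : Tor (fine n M) × Fin (d + 1), Real.exp (-((κ' - m) * torusSupNorm M (rep M yb - rep M (blockOf n M j.1))))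
      ≤ ((d + 1 : ℕ) : ℝ) * (n : ℝ) ^ (d + 1) * latticeConst (d + 1) (κ' - m) := by
    calc ∑ j : Tor (fine n M) × Fin (d + 1), Real.exp (-((κ' - m) * torusSupNorm M (rep M yb - rep M (blockOf n M j.1))))
        = ∑ _μ : Fin (d + 1), ∑ q : Tor (fine n M), Real.exp (-((κ' - m) * torusSupNorm M (rep M yb - rep M (blockOf n M q)))) := by
          rw [Fintype.sum_prod_type, Finset.sum_comm]
      _ = ∑ _μ : Fin (d + 1), ∑ y' : Tor M, ∑ _a : Fin (d + 1) → Fin n, Real.exp (-((κ' - m) * torusSupNorm M (rep M yb - rep M y'))) := by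
          refine Finset.sum_congr rfl fun μ _ => ?_
          have hb := (bpt_bijective n M).sum_comp (fun q : Tor (fine n M) => Real.exp (-((κ' - m) * torusSupNorm M (rep M yb - rep M (blockOf n M q)))))
          rw [Fintype.sum_prod_type] at hb
          rw [← hb]
          refine Finset.sum_congr rfl fun y' _ => Finset.sum_congr rfl fun a _ => ?_
          simp only [blockOf_bpt]
      _ = ((d + 1 : ℕ) : ℝ) * (n : ℝ) ^ (d + 1) * ∑ y' : Tor M, Real.exp (-((κ' - m) * torusSupNorm M (rep M yb - rep M y'))) := by
          have hsumA : ∀ c : ℝ, ∑ _a : Fin (d + 1) → Fin n, c = (n : ℝ) ^ (d + 1) * c := fun c => by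
            rw [Finset.sum_const, Finset.card_univ, Fintype.card_fun, Fintype.card_fin, Fintype.card_fin, nsmul_eq_mul]
            push_cast
            ring
          have hsumμ : ∀ c : ℝ, ∑ _μ : Fin (d + 1), c = ((d + 1 : ℕ) : ℝ) * c := fun c => by
            rw [Finset.sum_const, Finset.card_univ, Fintype.card_fin, nsmul_eq_mul]
          simp only [hsumA]
          rw [hsumμ, ← Finset.mul_sum]
          ring
      _ ≤ _ := mul_le_mul_of_nonneg_left htor (by positivity)
  have hK0 : 0 ≤ latticeConst (d + 1) (κ' - m) := latticeConst_nonneg _ hκm.le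
  calc ∑ j ∈ Sf, ‖HkOp n M j (yb, lam)‖
      ≤ ∑ j ∈ Sf, MG163 (d + 1) * periodConst (kappa163 (d + 1)) d
          * Real.exp (-((κ' - m) * torusSupNorm M (rep M yb - rep M (blockOf n M j.1)))) * Real.exp (m * (s - ℓ₀)) :=
        Finset.sum_le_sum hent
    _ ≤ ∑ j : Tor (fine n M) × Fin (d + 1), MG163 (d + 1) * periodConst (kappa163 (d + 1)) d
          * Real.exp (-((κ' - m) * torusSupNorm M (rep M yb - rep M (blockOf n M j.1)))) * Real.exp (m * (s - ℓ₀)) :=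
        Finset.sum_le_univ_sum_of_nonneg fun j => by positivity
    _ = MG163 (d + 1) * periodConst (kappa163 (d + 1)) d * Real.exp (m * (s - ℓ₀))
          * ∑ j : Tor (fine n M) × Fin (d + 1), Real.exp (-((κ' - m) * torusSupNorm M (rep M yb - rep M (blockOf n M j.1)))) := by
        rw [Finset.mul_sum]
        refine Finset.sum_congr rfl fun j _ => ?_
        ring
    _ ≤ MG163 (d + 1) * periodConst (kappa163 (d + 1)) d * Real.exp (m * (s - ℓ₀))
          * (((d + 1 : ℕ) : ℝ) * (n : ℝ) ^ (d + 1) * latticeConst (d + 1) (κ' - m)) :=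
        mul_le_mul_of_nonneg_left hall (by positivity)
    _ = _ := by ring

end Columns

/-! ## §4 The decaying row of `∇Δ_1⁻¹`, block by block -/

section Row

variable (n : ℕ) [NeZero n] (M : Fin (d + 1) → ℕ) [∀ μ, NeZero (M μ)]

/-- **THE (1.110) GRADIENT ROW SUMMED OVER BLOCKS**: with GAN24's `(δ₀, C)` of `Entry110Grad d 1`, for every source `J` bounded on each block `y′` by `B(y′)`:
`|(∇_νΔ_1⁻¹J)(x, μ)| ≤ C·Σ_{y′} e^{−δ₀|y₀ − y′|_T}·B(y′)` at every site `x` of the block `y₀` — decompose `J` into its block pieces (linearity), apply the entry to each.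
[folklore] -/
theorem norm_fdiff_inv_mulVec_le_blockwise {δ₀ C : ℝ}
    (hrow : ∀ (n : ℕ) (M : Fin (d + 1) → ℕ) [NeZero n] [∀ μ, NeZero (M μ)], 1 ≤ n →
      ∀ (ν : Fin (d + 1)) (y y' : Fin (d + 1) → ℤ) (J : Tor (fine n M) × Fin (d + 1) → ℂ) (B : ℝ),
        (∀ j, ‖J j‖ ≤ B) → (∀ j, J j ≠ 0 → ∃ r' : Fin (d + 1) → Fin n, j.1 = bpt n M (toT M y') r') →
        ∀ (r : Fin (d + 1) → Fin n) (μ : Fin (d + 1)),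
          ‖(fdiff (fine n M) (n : ℂ) ν *ᵥ ((DeltaA n M 1)⁻¹ *ᵥ J)) (bpt n M (toT M y) r, μ)‖
            ≤ C * Real.exp (-(δ₀ * torusSupNorm M (y - y'))) * B)
    (J : Tor (fine n M) × Fin (d + 1) → ℂ) (B : Tor M → ℝ) (hB : ∀ j, ‖J j‖ ≤ B (blockOf n M j.1))
    (y₀ : Tor M) (r : Fin (d + 1) → Fin n) (ν μ : Fin (d + 1)) :
    ‖(fdiff (fine n M) (n : ℂ) ν *ᵥ ((DeltaA n M 1)⁻¹ *ᵥ J)) (bpt n M y₀ r, μ)‖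
      ≤ C * ∑ y' : Tor M, Real.exp (-(δ₀ * torusSupNorm M (rep M y₀ - rep M y'))) * B y' := by
  classical
  have hn1 : 1 ≤ n := Nat.one_le_iff_ne_zero.mpr (NeZero.ne n)
  -- block pieces
  set piece : Tor M → (Tor (fine n M) × Fin (d + 1) → ℂ) := fun y' j => if blockOf n M j.1 = y' then J j else 0 with hpiece
  have hdec : J = ∑ y' : Tor M, piece y' := by
    funext j
    rw [Finset.sum_apply, Finset.sum_eq_single (blockOf n M j.1) (fun y' _ hy' => by rw [hpiece]; exact if_neg (Ne.symm hy'))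
      (fun h => absurd (Finset.mem_univ _) h)]
    rw [hpiece]; simp
  -- each piece: bounded by `B y′`, supported in the block `y′`
  have hPB : ∀ y' j, ‖piece y' j‖ ≤ B y' := by
    intro y' j
    simp only [hpiece]
    split_ifs with hj
    · rw [← hj]; exact hB j
    · rw [norm_zero]
      have h0 := hB (bpt n M y' r, μ)
      rw [blockOf_bpt] at h0
      exact (norm_nonneg _).trans h0
  have hPsupp : ∀ y' j, piece y' j ≠ 0 → ∃ r' : Fin (d + 1) → Fin n, j.1 = bpt n M (toT M (rep M y')) r' := by
    intro y' j hj
    simp only [hpiece] at hj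
    split_ifs at hj with hb
    · exact ⟨digitOf n M j.1, by rw [toT_rep, ← hb, bpt_blockOf_digitOf]⟩
    · exact absurd rfl hj
  -- linearity and the entry per piece
  have hlin : fdiff (fine n M) (n : ℂ) ν *ᵥ ((DeltaA n M 1)⁻¹ *ᵥ J)
      = ∑ y' : Tor M, fdiff (fine n M) (n : ℂ) ν *ᵥ ((DeltaA n M 1)⁻¹ *ᵥ piece y') := by
    rw [hdec, Matrix.mulVec_sum, Matrix.mulVec_sum]
  rw [hlin, Finset.sum_apply, Finset.mul_sum]
  refine (norm_sum_le _ _).trans (Finset.sum_le_sum fun y' _ => ?_)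
  have h := hrow n M hn1 ν (rep M y₀) (rep M y') (piece y') (B y') (hPB y') (hPsupp y') r μ
  rw [toT_rep] at h
  exact h.trans (le_of_eq (by ring))

end Row

end

end Summit.QuantumFields.BalabanUV.T4Continuum.NE7SliceGreenDecayRows
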